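import Summits.ValiantsHypothesis.ValiantsHypothesis.Theses.ProjectionStability
import Summits.ValiantsHypothesis.ValiantsHypothesis.Theorems.ProjectionRigidityProjOptimalUniqueRefutation
import Summits.ValiantsHypothesis.ValiantsHypothesis.Theorems.ProjectionStabilityUniqStepStubElementaryOps
import Summits.ValiantsHypothesis.ValiantsHypothesis.Theorems.ProjectionStabilityUniqStepStubCellsSpecial
import Summits.ValiantsHypothesis.ValiantsHypothesis.Theorems.ProjectionStabilityUniqStepStubCellsOther
import Summits.ValiantsHypothesis.ValiantsHypothesis.Theorems.ProjectionStabilityUniqStepStubAdjugate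
import Summits.ValiantsHypothesis.ValiantsHypothesis.Theorems.ProjectionStabilityUniqStepStubMinor
import Summits.ValiantsHypothesis.ValiantsHypothesis.Theorems.ProjectionStabilityUniqStepStubRankToolkit
import Summits.ValiantsHypothesis.ValiantsHypothesis.Theorems.ProjectionStabilityUniqStepStubGrenetRank
import Literature.Computability.AlgebraicComplexity.GrenetEquivariant
import Literature.Computability.AlgebraicComplexity.GrenetProjection
import Mathlib.LinearAlgebra.Matrix.Transvection

/-!
# Crux `ProjectionStability.UniqStep` (stmt-ValiantsHypothesis-17834) — PROVED (vacuously):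
# at every level `n ≥ 3` there are two inequivalent Grenet-size honest projections of `per_n`

CLAIM SETTLED. `UniqStep = ∀ n ≥ 3, Opt n → Uniq n → Opt (n+1) → Uniq (n+1)` (route
`ProjectionStability`, line `Sketch`), where `Opt n := 2ⁿ − 1 ≤ pdc(per_n)` and `Uniq n` says that any
two honest `pdc × pdc` projections of `per_n` (every cell a variable `X v` or a constant `C c`) are
related by constant gauge `GL × GL`, a realised symmetry of `per_n` (`permSymmetrySubst`) and possibly
transposition.  We prove it OUTRIGHT by showing that its antecedent `Uniq n` is FALSE at every level
`n ≥ 3` (under `Opt n`, which pins the optimal size to `m = 2ⁿ − 1`, Grenet):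

* `n = 3`: the tree's `not_ProjectionOptimalUniqueThree` (Grenet₃ versus its purified single-syzygy
  Koszul twist, `Theorems/ProjOptimalUnique/Negative/PurifiedTwist.lean`), after `pdc(per₃) = 7`.
* `n = k + 3 ≥ 4` (`not_uniqAt`): Grenet's matrix `Grenet.repr ℂ n e` versus the PURIFIED SOURCE TWIST
  `K_n`, the `ε`-signed `(univ, ∅)`-minor of `P · (1 − Grenet.adj) · EQ` with the explicit elementary
  matrices `P` (row operations `∅ ↦ −∅ + {0,1}`, `{0} ↦ {0} + {1,2}`, `{1} ↦ −∅ + {1} + {0,2}`,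
  `{l} ↦ {l} + {0,1}` for `l ≥ 2`) and `EQ` (the Koszul twist of the column `{1,2}` by
  `−X(1,0)·{0} + X(0,0)·{1}`, then `{1,2} ↦ {1,2} − {0}`, `{1} ↦ −{1} + {0,2}`, `{l} ↦ −{l}`):
  it is HONEST (`stub_cells_special`, `stub_cells_other`, `stub_minor`), has determinant `per_n` up to
  the sign `(−1)^k` fixed by a row swap (`stub_elementaryOps`, `stub_adjugate`, `stub_minor`), and the
  coefficient matrix of `X(0,0)` in it has rank `2` (`stub_minor`, `stub_rankToolkit`) whereas no
  coefficient matrix of Grenet's matrix has rank `2` (`stub_grenetRank`); since the coefficient-rank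
  profile is an invariant of the gauge relation (`stub_rankToolkit`, monomiality of
  `permSymmetrySubst`), the two optimal projections are inequivalent.

The construction is uniform in `n` (it only touches the rows `∅, {l}` and the columns `{l}, {1,2}`,
using the rows/columns `{0,1}, {0,2}, {1,2}`); it was found in this session by generalising the
`(3, 7)` purification and verified by exact computation for `n = 3, …, 7` before formalisation.
CONSEQUENCE FOR THE ROUTE: the stability thesis "optimality and uniqueness propagate together" is void
— uniqueness of Grenet-size projections fails at EVERY level `n ≥ 3` (not sporadically at `3`); the
Assembly's other antecedent `UniqBase` is refuted as well (`…UniqStep.Negative.not_uniqBase`).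
Phase 1 of the line (equality case of Landsberg–Ressayre Thm. 2.8, symmetry reduction
`uniqStep_iff_symStep`, `halfEq_iff_uniq`) remains valid and shows in particular that NOT every
optimal projection of `per_n` respects the left monomial symmetry (`not_halfEq_three`; for `n ≥ 4` the
same follows from `not_uniqAt` and `halfEq_iff_uniq` under `Opt n`).

No `sorry`, no named facts, no new definitions; axioms `propext`, `Classical.choice`, `Quot.sound`.
-/

-- D-0017 layout: Sub = Summit for this single-conjunct summit, so the namespace repeats a component.
set_option linter.dupNamespace false

namespace Summit.ValiantsHypothesis.ValiantsHypothesis.Theorems.ProjectionStabilityUniqStep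

open MvPolynomial
open scoped BigOperators Matrix
open Literature.Computability.AlgebraicComplexity
open Literature.Computability.AlgebraicComplexity.LRPencil

noncomputable section

/-! ## Two inequivalent optimal projections at every level `n ≥ 4` -/

/-- Two inequivalent honest `m × m` projections of `per_{k+3}`, `k ≥ 1`, `m + 1 = 2^(k+3)`: Grenet's
matrix and the purified source twist. Hence the uniqueness clause at `(k+3, m)` is false. [folklore] -/
theorem not_uniqAt (k m : ℕ) (hk : 1 ≤ k) (hm : m + 1 = 2 ^ (k + 3)) :
    ¬ ∀ A B : Matrix (Fin m) (Fin m) (MvPolynomial (Fin (k + 3) × Fin (k + 3)) ℂ),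
      (∀ i j, (∃ v, A i j = MvPolynomial.X v) ∨ ∃ c, A i j = MvPolynomial.C c) →
      (∀ i j, (∃ v, B i j = MvPolynomial.X v) ∨ ∃ c, B i j = MvPolynomial.C c) →
      A.det = perPoly (Fin (k + 3)) ℂ → B.det = perPoly (Fin (k + 3)) ℂ →
      ∃ (P Q : GL (Fin m) ℂ) (γ : GL (Fin (k + 3) × Fin (k + 3)) ℂ),
        γ ∈ permSymmetrySubst ℂ (k + 3) ∧
        (B = (P : Matrix _ _ ℂ).map MvPolynomial.C * Matrix.linSubstEntries γ A * (Q : Matrix _ _ ℂ).map MvPolynomial.C ∨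
          B = (P : Matrix _ _ ℂ).map MvPolynomial.C * (Matrix.linSubstEntries γ A).transpose *
            (Q : Matrix _ _ ℂ).map MvPolynomial.C) := by
  intro hU
  -- Grenet's matrix, honest (`e ∅ = 0`, `e univ = last`, `m` odd)
  have hn : (k + 3) ≠ 0 := by omega
  have hN : 2 ^ (k + 3) = m + 1 := hm.symm
  obtain ⟨e, he0, he1⟩ := Grenet.exists_equiv_empty_univ hn hN
  have hmodd : Odd m := by
    have h8 : 8 ∣ 2 ^ (k + 3) := ⟨2 ^ k, by ring⟩
    rcases h8 with ⟨c, hc⟩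
    exact ⟨4 * c - 1, by omega⟩
  have hpar : Odd ((e Finset.univ : ℕ) + (e ∅ : ℕ)) := by
    rw [he0, he1, Fin.val_last, Fin.val_zero, add_zero]; exact hmodd
  set A := Grenet.repr ℂ (k + 3) e with hA
  have hApure : ∀ i j, (∃ v, A i j = X v) ∨ ∃ c, A i j = C c := Grenet.repr_apply_isPure e hpar
  have hAdet : A.det = perPoly (Fin (k + 3)) ℂ := (Grenet.isAffineDetRepr_repr (k := ℂ) (n := k + 3) hn hN e).2
  -- the purified twist
  obtain ⟨hProw, hPdet, hEQcol, hEQdet⟩ := stub_elementaryOps k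
  set P := Matrix.diagonal (fun S : Finset (Fin (k + 3)) =>
            if S = ∅ then (-1 : MvPolynomial (Fin (k + 3) × Fin (k + 3)) ℂ) else 1) *
          Matrix.transvection (∅ : Finset (Fin (k + 3))) {0, 1} (-1) *
          Matrix.transvection ({1} : Finset (Fin (k + 3))) ∅ (-1) *
          Matrix.transvection ({1} : Finset (Fin (k + 3))) {0, 2} 1 *
          Matrix.transvection ({0} : Finset (Fin (k + 3))) {1, 2} 1 *
          (1 + ∑ l ∈ Finset.filter (fun l : Fin (k + 3) => 2 ≤ l.val) Finset.univ,
            Matrix.single ({l} : Finset (Fin (k + 3))) ({0, 1} : Finset (Fin (k + 3)))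
              (1 : MvPolynomial (Fin (k + 3) × Fin (k + 3)) ℂ)) with hPdef
  set EQ := Matrix.transvection ({0} : Finset (Fin (k + 3))) {1, 2} (-(X (1, 0))) *
          Matrix.transvection ({1} : Finset (Fin (k + 3))) {1, 2} (X (0, 0)) *
          Matrix.transvection ({0} : Finset (Fin (k + 3))) {1, 2} (-1) *
          Matrix.transvection ({0, 2} : Finset (Fin (k + 3))) {1} (-1) *
          Matrix.diagonal (fun T : Finset (Fin (k + 3)) =>
            if T.card = 1 then (-1 : MvPolynomial (Fin (k + 3) × Fin (k + 3)) ℂ) else 1) with hEQdef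
  set Kf := P * (1 - Grenet.adj ℂ (k + 3)) * EQ with hKf
  have hcells : ∀ S T : Finset (Fin (k + 3)), S ≠ Finset.univ → T ≠ ∅ →
      ((∃ v, Kf S T = -X v) ∨ ∃ c, Kf S T = C c) ∧
      MvPolynomial.coeff (Finsupp.single ((0 : Fin (k + 3)), (0 : Fin (k + 3))) 1) (Kf S T) =
        if (S = ∅ ∧ T = {0}) ∨ (S = {1} ∧ T = {0}) ∨ (S = ∅ ∧ T = {1, 2}) then -1 else 0 := by
    intro S T hS hT
    by_cases h : S = ∅ ∨ S = {0} ∨ S = {1}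
    · exact stub_cells_special k P EQ hProw hEQcol S T h hT
    · rw [not_or, not_or] at h
      obtain ⟨h1, h2, h3⟩ := h
      obtain ⟨hc, hz⟩ := stub_cells_other k P EQ hProw hEQcol S T hS h1 h2 h3 hT
      refine ⟨hc, ?_⟩
      rw [hz, if_neg]
      rintro (⟨h, -⟩ | ⟨h, -⟩ | ⟨h, -⟩)
      · exact h1 h
      · exact h3 h
      · exact h1 h
  have hadj : Kf.adjugate ∅ Finset.univ = (-1) ^ k * perPoly (Fin (k + 3)) ℂ :=
    stub_adjugate k P EQ hProw hPdet hEQcol hEQdet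
  obtain ⟨hKpure, hKdet, i₁, i₂, j₁, j₂, hi, hj, hKcoeff⟩ := stub_minor k m hm e he0 he1 Kf hcells hadj
  set K := ((-1 : MvPolynomial (Fin (k + 3) × Fin (k + 3)) ℂ) ^ ((e Finset.univ : ℕ) + (e ∅ : ℕ)) •
        ((Kf.submatrix e.symm e.symm).submatrix (Fin.succAbove (e Finset.univ)) (Fin.succAbove (e ∅)))) with hKdef
  obtain ⟨hprofile, hrank2, hrankperm⟩ := stub_rankToolkit
  -- sign fix: a row swap when `k` is odd
  obtain ⟨B, hBpure, hBdet, hBrank⟩ : ∃ B : Matrix (Fin m) (Fin m) (MvPolynomial (Fin (k + 3) × Fin (k + 3)) ℂ),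
      (∀ i j, (∃ v, B i j = X v) ∨ ∃ c, B i j = C c) ∧ B.det = perPoly (Fin (k + 3)) ℂ ∧
      (coeffMat B (0, 0)).rank = 2 := by
    have hrK : (coeffMat K (0, 0)).rank = 2 := by rw [hKcoeff]; exact hrank2 m i₁ i₂ j₁ j₂ hi hj
    rcases Nat.even_or_odd k with hke | hko
    · refine ⟨K, hKpure, ?_, hrK⟩
      rw [hKdet, hke.neg_one_pow, one_mul]
    · refine ⟨K.submatrix (Equiv.swap i₁ i₂) id, fun i j => hKpure _ _, ?_, ?_⟩
      · rw [Matrix.det_permute, hKdet, Equiv.Perm.sign_swap hi, hko.neg_one_pow]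
        simp
      · rw [hrankperm]; exact hrK
  -- compare with Grenet: the rank-2 variable of `B` has no partner in `A`
  obtain ⟨P', Q', γ, hγ, hrel⟩ := hU A B hApure hBpure hAdet hBdet
  obtain ⟨w, hw, hwr⟩ := hprofile (k + 3) m A B P' Q' γ hγ hApure hrel
  have h2 : (coeffMat A (w (0, 0))).rank = 2 := by rw [← hwr (0, 0)]; exact hBrank
  exact stub_grenetRank k m hk hm e (w (0, 0)) h2

/-- **The line concludes the crux BY NAME — vacuously**: at every level `n ≥ 3` with `Opt n` the
optimal size is `2ⁿ − 1` (Grenet), at which two inequivalent honest projections of `per_n` exist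
(`n = 3`: the tree's `not_ProjOptimalUniqueThree`; `n ≥ 4`: `not_uniqAt`), so the antecedent `Uniq n`
of the step is false. [folklore] -/
theorem uniqStep_proof :
    Summit.ValiantsHypothesis.ValiantsHypothesis.Theses.ProjectionStability.UniqStep := by
  intro n hn hopt huniq hopt'
  exfalso
  have hpdc : detProjectionComplexity (perPoly (Fin n) ℂ) = 2 ^ n - 1 :=
    detProjectionComplexity_perPoly_eq_of_le ℂ (by omega) hopt
  rcases Nat.lt_or_ge n 4 with h3 | h4
  · obtain rfl : n = 3 := by omega
    rw [detProjectionComplexity_perPoly_three] at huniq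
    exact Summit.ValiantsHypothesis.ValiantsHypothesis.Theorems.not_ProjOptimalUniqueThree huniq
  · obtain ⟨k, rfl⟩ : ∃ k, n = k + 3 := ⟨n - 3, by omega⟩
    have hk : 1 ≤ k := by omega
    have hm : (2 ^ (k + 3) - 1) + 1 = 2 ^ (k + 3) := by
      have := Nat.one_le_two_pow (n := k + 3); omega
    rw [hpdc] at huniq
    exact not_uniqAt k (2 ^ (k + 3) - 1) hk hm huniq


end

end Summit.ValiantsHypothesis.ValiantsHypothesis.Theorems.ProjectionStabilityUniqStep
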